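import Summits.FinalStateConjecture.FinalStateConjecture.Theorems.PhotonSphereChannelsTameCensorshipLensCausality
import Literature.Geometry.Lorentzian.CauchyDevelopmentRestrict
import Literature.Geometry.Lorentzian.LorentzianDistance
import Literature.Geometry.Lorentzian.Einstein
import Summits.FinalStateConjecture.FinalStateConjecture.Theorems.ZeroEnergyKerrOrBombZeroEnergyRigidityStubFuturePresentationOpens
import HarnessLib

/-!
# Crux `TameCensorship` (stmt-FinalStateConjecture-10047), line `crush-the-swallowed-interior`,
# fact-stub F1 `stub_factFutureCauchyCrushBound` — V(a): transport to an open sub-spacetime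

Bookkeeping for the passage from a spacetime `𝓢` to an open sub-spacetime `U`
(`LorentzianMetric.restrict`, `TimeOrientation.restrict`, `Spacetime.restrict`): `T_p U = T_p 𝓢`,
the restricted metric is the pullback along the inclusion
(`PseudoRiemannianMetric.restrict_eq_comap`), and all local geometric objects agree.

* Curves and lengths: `isFutureCausalCurveOn_congr_iff`, `speed_restrict`, `arcLength_restrict`,
  and **`lorentzDist_le_lorentzDist_restrict`** — if every future causal curve of `𝓢` from `p` to
  `q` stays in `U`, then `d_𝓢(p, q) ≤ d_U(p, q)` (lift the curves into `U`, `exists_lift_opens`;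
  they are causal curves of `U`, `FuturePresentation.isFutureCausalCurveOn_restrict_iff` of the
  `ZeroEnergyRigidity` files; same lengths);
* Hypersurfaces: for `f : N → 𝓢` with values in `U` and its codomain restriction `f₀ : N → U`
  (written `fun z ↦ ⟨f z, _⟩`): `mfderiv_codRestrict_apply` (`df₀ = df`), `contMDiff_codRestrict`,
  `isSpacelikeImmersion_codRestrict`, `contMDiff_normal_codRestrict` (smooth lifts to `TU`),
  `isFutureUnitNormal_codRestrict`, and **`meanCurvature_codRestrict`** — `H^{g|_U}_{f₀, ν} =
  H^{g}_{f, ν}` (`meanCurvature_comap` of `HypersurfaceNaturality` along the inclusion);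
* Curvature: `satisfiesTimelikeConvergence_restrict` — `Ric(g|_U) = Ric(g)|_U`
  (`ricci_comap_apply`), so the timelike convergence condition restricts.

These feed Wald's Cauchy form of Hawking's crush bound (`HawkingCrushBound`) on the globally
hyperbolic region of a future Cauchy hypersurface (`…TameCensorshipFutureCauchyDomain`) in step
V(b). Everything is proved; no definitions, no named facts.

## References

* B. O'Neill, *Semi-Riemannian geometry with applications to relativity*, Academic Press 1983,
  Ch. 1, pp. 3–7 and Ch. 3, p. 57, pp. 90–91 (open submanifolds, local isometries), Ch. 4,
  Lemma 4.4 ff.; Ch. 14, Def. 14.15 (time separation). [ONeillSemiRiemannian1983]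
* J. M. Lee, *Introduction to Smooth Manifolds*, 2nd ed. (2013), Prop. 3.9 (`T_p U = T_p M`).
-/

noncomputable section

-- The tree namespace `Summit.FinalStateConjecture.FinalStateConjecture.…` (summit = sub-problem)
-- repeats a component by design (D-0022), which the `dupNamespace` linter would flag on every decl.
set_option linter.dupNamespace false

open Bundle Set Filter Function Topology TopologicalSpace MeasureTheory
open scoped Manifold ContDiff Topology

open Literature.Geometry.Lorentzian
open Summit.FinalStateConjecture.FinalStateConjecture.Theorems.ZeroEnergyRigidity.GlobalHorizonKillingField.FuturePresentation
  (isFutureCausalCurveOn_restrict_iff)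

namespace Summit.FinalStateConjecture.FinalStateConjecture.Theorems.PhotonSphereChannels.TameCensorshipCrush

/-! ### Curves, lengths and the time separation in an open sub-spacetime -/

section Curves

variable {E : Type*} [NormedAddCommGroup E] [NormedSpace ℝ E] {H : Type*} [TopologicalSpace H]
  {I : ModelWithCorners ℝ E H} {n : ℕ∞ω} {M : Type*} [TopologicalSpace M] [ChartedSpace H M]
  [IsManifold I ∞ M]

variable {g : LorentzianMetric I n M} {τ : TimeOrientation g}
  (hres : PseudoRiemannianMetric.contMDiff_restrict (I := I) (n := n) (M := M))
  (hτ : τ.contMDiff_restrict) (U : Opens M)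

/-- Being a future causal curve on `s` is a local property of the germs of the curve at the
points of `s` (causal analogue of `isFutureTimelikeCurveOn_congr_iff`). [folklore] -/
theorem isFutureCausalCurveOn_congr_iff {γ γ' : ℝ → M} {s : Set ℝ}
    (h : ∀ t ∈ s, γ' =ᶠ[𝓝 t] γ) :
    g.IsFutureCausalCurveOn τ γ' s ↔ g.IsFutureCausalCurveOn τ γ s := by
  have key : ∀ {γ₁ γ₂ : ℝ → M}, (∀ t ∈ s, γ₂ =ᶠ[𝓝 t] γ₁) →
      g.IsFutureCausalCurveOn τ γ₁ s → g.IsFutureCausalCurveOn τ γ₂ s := by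
    intro γ₁ γ₂ h12 hγ t ht
    obtain ⟨hd, hfd⟩ := hγ t ht
    have heq : γ₂ t = γ₁ t := (h12 t ht).eq_of_nhds
    have hd' : MDifferentiableAt 𝓘(ℝ, ℝ) I γ₂ t := (h12 t ht).mdifferentiableAt_iff.mpr hd
    have hv : HEq (velocity I γ₂ t) (velocity I γ₁ t) := by
      unfold velocity
      have hm := (h12 t ht).mfderiv_eq (I := 𝓘(ℝ, ℝ)) (I' := I)
      congr 1
    refine ⟨hd', ?_⟩
    have aux : ∀ (x y : M) (hxy : x = y) (v : TangentSpace I x) (w : TangentSpace I y),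
        HEq v w → τ.IsFutureDirected w → τ.IsFutureDirected v := by
      rintro x y rfl v w hvw hw
      rw [heq_iff_eq] at hvw
      rw [hvw]; exact hw
    exact aux _ _ heq _ _ hv hfd
  exact ⟨key fun t ht ↦ (h t ht).symm, key h⟩

/-- The speed of a curve of an open sub-spacetime is its speed in the ambient spacetime.
[folklore] -/
theorem speed_restrict (γ : ℝ → U) (t : ℝ) :
    (g.restrict hres U).toPseudoRiemannianMetric.speed γ t =
      g.toPseudoRiemannianMetric.speed (Subtype.val ∘ γ) t := by
  have hv := velocity_subtypeVal_comp (I := I) U γ t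
  change Real.sqrt |g.val (γ t).1 (velocity I γ t) (velocity I γ t)| =
    Real.sqrt |g.val (γ t).1 (velocity I (Subtype.val ∘ γ) t) (velocity I (Subtype.val ∘ γ) t)|
  rw [hv]

/-- The arc length of a curve of an open sub-spacetime is its arc length in the ambient
spacetime. O'Neill 1983, Ch. 5, Def. 5.11. [folklore] -/
theorem arcLength_restrict (γ : ℝ → U) (a b : ℝ) :
    (g.restrict hres U).toPseudoRiemannianMetric.arcLength γ a b =
      g.toPseudoRiemannianMetric.arcLength (Subtype.val ∘ γ) a b := by
  simp only [PseudoRiemannianMetric.arcLength_eq_lintegral_Icc, speed_restrict]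

variable {U} in
/-- **The time separation does not increase in an open sub-spacetime which keeps the competing
curves**: if every future causal curve segment of `M` from `p ∈ U` to `q ∈ U` stays in `U`, then
`d_M(p, q) ≤ d_U(p, q)` (each segment lifts to a future causal segment of `U` of the same length).
O'Neill 1983, Ch. 14, Def. 14.15. [cite: ONeillSemiRiemannian1983, Ch. 14, Def. 14.15 (p. 409)] -/
theorem lorentzDist_le_lorentzDist_restrict {p q : M} (hp : p ∈ U) (hq : q ∈ U)
    (hstay : ∀ (γ : ℝ → M) (a b : ℝ), a < b → g.IsFutureCausalCurveOn τ γ (Icc a b) → γ a = p →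
      γ b = q → ∀ t ∈ Icc a b, γ t ∈ U) :
    g.lorentzDist τ p q ≤
      (g.restrict hres U).lorentzDist (τ.restrict hres hτ U) ⟨p, hp⟩ ⟨q, hq⟩ := by
  rw [LorentzianMetric.lorentzDist_le_iff]
  intro γ a b hab hγ ha hb
  obtain ⟨γ', hγ'⟩ := exists_lift_opens (O := (U : Set M)) hp γ
  have hU := hstay γ a b hab hγ ha hb
  have hagree : EqOn (Subtype.val ∘ γ') γ (Icc a b) := fun t ht ↦ hγ' t (hU t ht)
  have hγ'c : (g.restrict hres U).IsFutureCausalCurveOn (τ.restrict hres hτ U) γ' (Icc a b) := by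
    rw [isFutureCausalCurveOn_restrict_iff g τ hres hτ U]
    exact (isFutureCausalCurveOn_congr_iff fun t ht ↦
      eventuallyEq_of_lift U.isOpen hγ' (hγ t ht).1.continuousAt (hU t ht)).mpr hγ
  have ha' : γ' a = ⟨p, hp⟩ := Subtype.ext ((hagree ⟨le_rfl, hab.le⟩).trans ha)
  have hb' : γ' b = ⟨q, hq⟩ := Subtype.ext ((hagree ⟨hab.le, le_rfl⟩).trans hb)
  calc g.toPseudoRiemannianMetric.arcLength γ a b
      = g.toPseudoRiemannianMetric.arcLength (Subtype.val ∘ γ') a b :=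
        PseudoRiemannianMetric.arcLength_congr hagree.symm
    _ = (g.restrict hres U).toPseudoRiemannianMetric.arcLength γ' a b :=
        (arcLength_restrict hres U γ' a b).symm
    _ ≤ (g.restrict hres U).lorentzDist (τ.restrict hres hτ U) ⟨p, hp⟩ ⟨q, hq⟩ :=
        LorentzianMetric.arcLength_le_lorentzDist hab hγ'c ha' hb'

end Curves

/-! ### Hypersurfaces and curvature in an open sub-spacetime of a spacetime -/

section Hypersurface

universe u

variable (𝓢 : Spacetime.{u} 4) (U : Opens 𝓢.carrier)
  {N : Type u} [TopologicalSpace N] [ChartedSpace E3 N]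
  {f : N → 𝓢.carrier} (hfU : ∀ z, f z ∈ U)

/-- A map into an open sub-spacetime is `C^m` iff its composite with the inclusion is; here:
the codomain restriction of a `C^m` map with values in `U` is `C^m`. [folklore] -/
theorem contMDiff_codRestrict {m : ℕ∞ω} (hf : ContMDiff (𝓡 3) (𝓡 4) m f) :
    ContMDiff (𝓡 3) (𝓡 4) m (fun z ↦ (⟨f z, hfU z⟩ : U)) := by
  intro z
  have h : ContMDiffWithinAt (𝓡 3) (𝓡 4) m (Subtype.val ∘ fun z ↦ (⟨f z, hfU z⟩ : U)) univ z ↔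
      ContMDiffWithinAt (𝓡 3) (𝓡 4) m (fun z ↦ (⟨f z, hfU z⟩ : U)) univ z :=
    ChartedSpace.liftPropWithinAt_subtypeVal_comp_iff ..
  exact h.mp (hf z).contMDiffWithinAt

/-- **`df₀ = df`** for the codomain restriction `f₀` of a differentiable map `f` with values in
the open sub-spacetime `U` (`d(Subtype.val) = id`). Lee 2013, Prop. 3.9. [folklore] -/
theorem mfderiv_codRestrict_apply {z : N} (hf : MDifferentiableAt (𝓡 3) (𝓡 4) f z)
    (v : TangentSpace (𝓡 3) z) :
    mfderiv (𝓡 3) (𝓡 4) (fun z ↦ (⟨f z, hfU z⟩ : U)) z v = mfderiv (𝓡 3) (𝓡 4) f z v := by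
  have hf₀ : MDifferentiableAt (𝓡 3) (𝓡 4) (fun z ↦ (⟨f z, hfU z⟩ : U)) z :=
    (mdifferentiableAt_subtypeVal_comp_iff U).1 hf
  have h := mfderiv_comp z (hasMFDerivAt_subtypeVal (I' := 𝓡 4) (W := U) ⟨f z, hfU z⟩).mdifferentiableAt hf₀
  have h' := DFunLike.congr_fun h v
  change mfderiv (𝓡 3) (𝓡 4) f z v = mfderiv (𝓡 4) (𝓡 4) (Subtype.val : U → 𝓢.carrier) ⟨f z, hfU z⟩
    (mfderiv (𝓡 3) (𝓡 4) (fun z ↦ (⟨f z, hfU z⟩ : U)) z v) at h'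
  rw [mfderiv_subtypeVal] at h'
  exact h'.symm

/-- **A spacelike immersion with values in `U` is a spacelike immersion into `(U, g|_U)`.**
O'Neill 1983, Ch. 3, p. 57 and Ch. 4, p. 97. [cite: ONeillSemiRiemannian1983, Ch. 4, p. 97] -/
theorem isSpacelikeImmersion_codRestrict (hf : 𝓢.metric.IsSpacelikeImmersion (𝓡 3) f) :
    (𝓢.metric.restrict PseudoRiemannianMetric.contMDiff_restrict_holds U).IsSpacelikeImmersion
      (𝓡 3) (fun z ↦ (⟨f z, hfU z⟩ : U)) := by
  refine ⟨contMDiff_codRestrict 𝓢 U hfU hf.1, fun z v hv ↦ ?_⟩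
  have hd : MDifferentiableAt (𝓡 3) (𝓡 4) f z := (hf.contMDiff z).mdifferentiableAt (by simp)
  have h := hf.2 z v hv
  rw [PseudoRiemannianMetric.inducedBilin_apply] at h ⊢
  rw [mfderiv_codRestrict_apply 𝓢 U hfU hd]
  exact h

/-- **A smooth field along `f` into `T𝓢` is a smooth field along `f₀` into `TU`** (the
preferred trivialisations of `TU` and `T𝓢` have the same fibre coordinates,
`trivializationAt_tangentSpace_opens_snd`). Lee 2013, Prop. 3.9. [folklore] -/
theorem contMDiff_normal_codRestrict {ν : NormalField (𝓡 4) f}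
    (hν : ContMDiff (𝓡 3) (𝓡 4).tangent ∞
      (fun y ↦ (TotalSpace.mk' E4 (f y) (ν y) : TangentBundle (𝓡 4) 𝓢.carrier))) :
    ContMDiff (𝓡 3) (𝓡 4).tangent ∞
      (fun y ↦ (TotalSpace.mk' E4 (⟨f y, hfU y⟩ : U) (ν y) : TangentBundle (𝓡 4) U)) := by
  intro z
  have h := hν z
  rw [contMDiffAt_totalSpace] at h ⊢
  refine ⟨?_, ?_⟩
  · exact contMDiff_codRestrict 𝓢 U hfU (fun z ↦ (contMDiffAt_totalSpace.1 (hν z)).1) z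
  · have hfun : (fun x ↦ ((trivializationAt E4 (TangentSpace (𝓡 4)) (⟨f z, hfU z⟩ : U))
        (TotalSpace.mk' E4 (⟨f x, hfU x⟩ : U) (ν x) : TangentBundle (𝓡 4) U)).2) =
        fun x ↦ ((trivializationAt E4 (TangentSpace (𝓡 4)) (f z))
          (TotalSpace.mk' E4 (f x) (ν x) : TangentBundle (𝓡 4) 𝓢.carrier)).2 :=
      funext fun x ↦ trivializationAt_tangentSpace_opens_snd (I := 𝓡 4) U ⟨f z, hfU z⟩ ⟨f x, hfU x⟩ (ν x)
    rw [hfun]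
    exact h.2

/-- **The future unit normal of `f` is the future unit normal of `f₀` in `(U, g|_U, τ|_U)`.**
O'Neill 1983, Ch. 4, pp. 106–107. [cite: ONeillSemiRiemannian1983, Ch. 4, pp. 106–107] -/
theorem isFutureUnitNormal_codRestrict (hf : 𝓢.metric.IsSpacelikeImmersion (𝓡 3) f)
    {ν : NormalField (𝓡 4) f} (hfun : 𝓢.metric.IsFutureUnitNormal (𝓡 3) 𝓢.timeOrientation f ν) :
    (𝓢.metric.restrict PseudoRiemannianMetric.contMDiff_restrict_holds U).IsFutureUnitNormal (𝓡 3)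
      (𝓢.timeOrientation.restrict PseudoRiemannianMetric.contMDiff_restrict_holds
        𝓢.timeOrientation.contMDiff_restrict_holds U)
      (fun z ↦ (⟨f z, hfU z⟩ : U)) (fun z ↦ ν z) := by
  refine ⟨⟨fun z v ↦ ?_, fun z ↦ hfun.1.2 z⟩, fun z ↦ hfun.2 z⟩
  have hd : MDifferentiableAt (𝓡 3) (𝓡 4) f z := (hf.contMDiff z).mdifferentiableAt (by simp)
  change 𝓢.metric.val (f z) (ν z) (mfderiv (𝓡 3) (𝓡 4) (fun z ↦ (⟨f z, hfU z⟩ : U)) z v) = 0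
  rw [mfderiv_codRestrict_apply 𝓢 U hfU hd]
  exact hfun.1.1 z v

/-- Equal metrics have equal mean curvatures (whatever the proofs of the standing hypotheses).
[folklore] -/
theorem meanCurvature_congr_metric [IsManifold (𝓡 3) ∞ N] {M : Type u} [TopologicalSpace M]
    [ChartedSpace E4 M] [IsManifold (𝓡 4) ∞ M]
    {g₁ g₂ : PseudoRiemannianMetric (𝓡 4) ∞ E4 (TangentSpace (𝓡 4) : M → Type _)} (h : g₁ = g₂)
    (i₁ : g₁.HasLeviCivita) (i₂ : g₂.HasLeviCivita) {φ : N → M}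
    (hpb : PseudoRiemannianMetric.contMDiff_pullbackBilin (𝓡 4) M (𝓡 3) N ∞)
    (h₁ : g₁.IsSpacelikeImmersion (𝓡 3) φ) (h₂ : g₂.IsSpacelikeImmersion (𝓡 3) φ)
    (ν : NormalField (𝓡 4) φ) (y : N) :
    g₁.meanCurvature φ hpb h₁ ν y = g₂.meanCurvature φ hpb h₂ ν y := by
  subst h; rfl

/-- **Locality of the mean curvature under passage to an open sub-spacetime**:
`H^{g|_U}_{f₀, ν}(z) = H^{g}_{f, ν}(z)` for the codomain restriction `f₀` of a spacelike immersion
`f` with values in `U` and a field `ν` along it, differentiable at `z` as a map `N → T𝓢` (the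
restricted metric is the pullback along the inclusion, `PseudoRiemannianMetric.restrict_eq_comap`,
and the mean curvature is natural under this local isometry,
`PseudoRiemannianMetric.meanCurvature_comap`). O'Neill 1983, Ch. 4, Lemma 4.4 ff. with Ch. 3,
Prop. 3.59. [cite: ONeillSemiRiemannian1983, Ch. 3, Prop. 3.59 and Ch. 4, Lemma 4.4] -/
theorem meanCurvature_codRestrict [IsManifold (𝓡 3) ∞ N] [𝓢.metric.HasLeviCivita]
    (hf : 𝓢.metric.IsSpacelikeImmersion (𝓡 3) f)
    (hpb : PseudoRiemannianMetric.contMDiff_pullbackBilin (𝓡 4) 𝓢.carrier (𝓡 3) N ∞)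
    (hpbU : PseudoRiemannianMetric.contMDiff_pullbackBilin (𝓡 4) U (𝓡 3) N ∞)
    [(𝓢.metric.restrict PseudoRiemannianMetric.contMDiff_restrict_holds U).HasLeviCivita]
    {ν : NormalField (𝓡 4) f} {z : N}
    (hν : MDifferentiableAt (𝓡 3) (𝓡 4).tangent
      (fun y ↦ (TotalSpace.mk' E4 (f y) (ν y) : TangentBundle (𝓡 4) 𝓢.carrier)) z) :
    (𝓢.metric.restrict PseudoRiemannianMetric.contMDiff_restrict_holds U).meanCurvature
        (fun z ↦ (⟨f z, hfU z⟩ : U)) hpbU (isSpacelikeImmersion_codRestrict 𝓢 U hfU hf)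
        (fun z ↦ ν z) z =
      𝓢.metric.meanCurvature f hpb hf ν z := by
  haveI := 𝓢.metric.toPseudoRiemannianMetric.hasLeviCivita
  -- the restricted metric is the pullback along the inclusion
  set gc := 𝓢.metric.toPseudoRiemannianMetric.comap
    PseudoRiemannianMetric.contMDiff_pullbackBilin_holds (Subtype.val : U → 𝓢.carrier)
    contMDiff_subtype_val (injective_mfderiv_subtypeVal U) rfl with hgc_def
  haveI hgcLC : gc.HasLeviCivita := gc.hasLeviCivita
  have hgc : (𝓢.metric.restrict PseudoRiemannianMetric.contMDiff_restrict_holds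
      U).toPseudoRiemannianMetric = gc :=
    PseudoRiemannianMetric.restrict_eq_comap 𝓢.metric.toPseudoRiemannianMetric U
  have hf₀ := isSpacelikeImmersion_codRestrict 𝓢 U hfU hf
  have hfc : gc.IsSpacelikeImmersion (𝓡 3) (fun z ↦ (⟨f z, hfU z⟩ : U)) := hgc ▸ hf₀
  have hΦf : 𝓢.metric.toPseudoRiemannianMetric.IsSpacelikeImmersion (𝓡 3)
      ((Subtype.val : U → 𝓢.carrier) ∘ fun z ↦ (⟨f z, hfU z⟩ : U)) := hf
  have key := PseudoRiemannianMetric.meanCurvature_comap 𝓢.metric.toPseudoRiemannianMetric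
    PseudoRiemannianMetric.contMDiff_pullbackBilin_holds (Φ := (Subtype.val : U → 𝓢.carrier))
    contMDiff_subtype_val (injective_mfderiv_subtypeVal U) rfl (hpbN := hpbU) (hpbM := hpb)
    (f := fun z ↦ (⟨f z, hfU z⟩ : U)) hfc hΦf (ν := fun z ↦ ν z) (y := z)
    BoundarylessManifold.isInteriorPoint ((mdifferentiableAt_totalSpace_opens_iff U).2 hν)
  have hnormal : (fun x ↦ mfderiv (𝓡 4) (𝓡 4) (Subtype.val : U → 𝓢.carrier)
      ((fun z ↦ (⟨f z, hfU z⟩ : U)) x) (ν x)) = ν := by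
    funext x; rw [mfderiv_subtypeVal]; rfl
  rw [hnormal] at key
  rw [meanCurvature_congr_metric (N := N) hgc inferInstance hgcLC hpbU hf₀ hfc, key]
  rfl

/-- **The timelike convergence condition restricts to open sub-spacetimes**:
`Ric(g|_U)_x(v, v) = Ric(g)_x(v, v) ≥ 0` for timelike `v ∈ T_x U = T_x 𝓢` (locality of the
curvature, `PseudoRiemannianMetric.ricci_comap_apply` along the inclusion). Hawking–Ellis 1973,
§4.3; O'Neill 1983, Ch. 3, Prop. 3.59. [cite: ONeillSemiRiemannian1983, Ch. 3, Prop. 3.59] -/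
theorem satisfiesTimelikeConvergence_restrict [𝓢.metric.HasLeviCivita]
    (htc : 𝓢.metric.SatisfiesTimelikeConvergence)
    [(𝓢.metric.restrict PseudoRiemannianMetric.contMDiff_restrict_holds U).HasLeviCivita] :
    (𝓢.metric.restrict PseudoRiemannianMetric.contMDiff_restrict_holds U).SatisfiesTimelikeConvergence := by
  intro x v hv
  haveI := 𝓢.metric.toPseudoRiemannianMetric.hasLeviCivita
  set gc := 𝓢.metric.toPseudoRiemannianMetric.comap
    PseudoRiemannianMetric.contMDiff_pullbackBilin_holds (Subtype.val : U → 𝓢.carrier)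
    contMDiff_subtype_val (injective_mfderiv_subtypeVal U) rfl with hgc_def
  haveI hgcLC : gc.HasLeviCivita := gc.hasLeviCivita
  have hgc : (𝓢.metric.restrict PseudoRiemannianMetric.contMDiff_restrict_holds
      U).toPseudoRiemannianMetric = gc :=
    PseudoRiemannianMetric.restrict_eq_comap 𝓢.metric.toPseudoRiemannianMetric U
  change 0 ≤ (𝓢.metric.restrict PseudoRiemannianMetric.contMDiff_restrict_holds
      U).toPseudoRiemannianMetric.ricci x v v
  rw [PseudoRiemannianMetric.ricci_congr_metric hgc inferInstance hgcLC]
  have key : gc.ricci x v v = 𝓢.metric.toPseudoRiemannianMetric.ricci x.1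
      (mfderiv (𝓡 4) (𝓡 4) (Subtype.val : U → 𝓢.carrier) x v)
      (mfderiv (𝓡 4) (𝓡 4) (Subtype.val : U → 𝓢.carrier) x v) :=
    PseudoRiemannianMetric.ricci_comap_apply 𝓢.metric.toPseudoRiemannianMetric
      PseudoRiemannianMetric.contMDiff_pullbackBilin_holds (Φ := (Subtype.val : U → 𝓢.carrier))
      contMDiff_subtype_val (injective_mfderiv_subtypeVal U) rfl x v v
  rw [key, mfderiv_subtypeVal]
  exact htc x.1 v hv

end Hypersurface

end Summit.FinalStateConjecture.FinalStateConjecture.Theorems.PhotonSphereChannels.TameCensorshipCrush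

end
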